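import Summits.AtomisticToContinuum.Crystallization.Theses.ThreeConeCertificate
import Summits.AtomisticToContinuum.Crystallization.Theorems.ChargedEnergyGap.Negative.BlocksBound
import Summits.AtomisticToContinuum.Crystallization.Theorems.ChargedEnergyGap.Negative.Periodisation
import Summits.AtomisticToContinuum.Crystallization.Theorems.ThreeConeCertificateKeplerBound

/-!
# Crux `ExactCertificate` (stmt-AtomisticToContinuum-11959), line `closure-makes-nogap-exact`:
# reductions for the stub `stub_periodicMinimum`

Support file — nothing here closes an item.  The line's skeleton for the crux
`ThreeConeCertificate.ExactCertificate` isolates the stub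

`stub_periodicMinimum : ∃ P : PeriodicConfiguration 3, ∀ Q, e_LJ(P) ≤ e_LJ(Q)`,

i.e. the infimum `e* = ⨅_Q e_LJ(Q)` (`ChargedEnergyGapNegative.eStar`, a genuine infimum by
`bddBelow_energyPerParticle_lennardJones`) of the Lennard-Jones energy per particle over the
periodic configurations of `ℝ³` is ATTAINED.  This is the attained-minimum half of conjunct (i)
of the summit, `HasPeriodicGroundStateEnergy lennardJones 3` (Blanc–Lewin 2015, §2.3: open in
dimension three), and we certify exactly that, as kernel-checked equivalences:

* `periodicMinimum_iff_exists_isLeast`, `periodicMinimum_iff_exists_eq_eStar` — the stub says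
  that some `e_LJ(P)` is a least element of the range, equivalently that some periodic `P` has
  `e_LJ(P) = e*` (`eStar_le`, `le_ciInf`);
* `stub_periodicMinimum_iff_keplerBound` — **stub ↔ `KeplerBound`** (route item
  stmt-AtomisticToContinuum-11961, `∃ P, ∀ N x injective, N · e_LJ(P) ≤ E_LJ(x)`), through the
  landed `keplerBound_iff_exists_isLeast` (periodisation `N · e* ≤ E_LJ(x)` one way, block trial
  states `E_LJ(y) < N (e* + δ)` the other);
* `stub_periodicMinimum_iff_hasPeriodicGroundStateEnergy` — **stub ↔ conjunct (i)**, through the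
  landed `keplerBound_iff_hasPeriodicGroundStateEnergy` (`E(N)/N → e*` unconditionally);
* `stub_periodicMinimum_of_keplerBound`, `keplerBound_of_periodicMinimum` — the two directions
  as one-liners for the line's composition.

So the stub is open exactly as item 11961 and conjunct (i) are open; no proof and no disproof is
claimed here.  (The same equivalences, phrased with `PeriodicMinimiser := ∃ P, e_LJ(P) = e*`, were
first checked in the refuter's work file `Cruxes/ExactCertificate/Disproof.lean` §2 —
`keplerBound_iff_periodicMinimiser`, `periodicMinimiser_iff_conjunct_i` — which is not
importable from `Theorems/`; here they rest on the landed support file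
`Theorems/ThreeConeCertificateKeplerBound.lean` of item 11961.)
-/

noncomputable section

namespace Summit.AtomisticToContinuum.Crystallization.Theorems.ThreeConeCertificateExactCertificate

open Literature.MathematicalPhysics.StatisticalMechanics
open Summit.AtomisticToContinuum.Crystallization.Theses.ThreeConeCertificate (KeplerBound)
open Summit.AtomisticToContinuum.Crystallization.Theorems.ChargedEnergyGapNegative (eStar eStar_le)

/-- **The stub says that some `e_LJ(P)` is a least element of the range of the energy per
particle over periodic configurations of `ℝ³`** (pure order bookkeeping). [folklore] -/
theorem periodicMinimum_iff_exists_isLeast :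
    (∃ P : PeriodicConfiguration 3, ∀ Q : PeriodicConfiguration 3,
        P.energyPerParticle lennardJones ≤ Q.energyPerParticle lennardJones) ↔
      ∃ P : PeriodicConfiguration 3,
        IsLeast (Set.range fun Q : PeriodicConfiguration 3 => Q.energyPerParticle lennardJones)
          (P.energyPerParticle lennardJones) := by
  refine exists_congr fun P => ⟨fun h => ⟨⟨P, rfl⟩, ?_⟩, fun h Q => h.2 ⟨Q, rfl⟩⟩
  rintro _ ⟨Q, rfl⟩
  exact h Q

/-- **The stub says that some periodic `P` has `e_LJ(P) = e*`**: `e* ≤ e_LJ(Q)` for every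
periodic `Q` (`eStar_le`, the range is bounded below), and a lower bound of the range is `≤ e*`
(`le_ciInf`). [folklore] -/
theorem periodicMinimum_iff_exists_eq_eStar :
    (∃ P : PeriodicConfiguration 3, ∀ Q : PeriodicConfiguration 3,
        P.energyPerParticle lennardJones ≤ Q.energyPerParticle lennardJones) ↔
      ∃ P : PeriodicConfiguration 3, P.energyPerParticle lennardJones = eStar := by
  -- adapted from Cruxes/ExactCertificate/Disproof.lean §2 (`PeriodicMinimiser`)
  refine exists_congr fun P => ⟨fun h => le_antisymm (le_ciInf h) (eStar_le P), fun h Q => ?_⟩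
  rw [h]
  exact eStar_le Q

/-- **(a) `stub_periodicMinimum ↔ KeplerBound`** (route item stmt-AtomisticToContinuum-11961):
the finite-`N` Kepler bound for Lennard-Jones holds for some periodic `P` iff the periodic
infimum of the energy per particle is attained — `→` by the block trial states
`E_LJ(y) < N (e* + δ)` (`exists_trialState`), `←` by periodisation `N · e* ≤ E_LJ(x)`
(`card_mul_eStar_le_interactionEnergy`); both packaged in the landed
`keplerBound_iff_exists_isLeast`. [folklore] -/
theorem stub_periodicMinimum_iff_keplerBound :
    (∃ P : PeriodicConfiguration 3, ∀ Q : PeriodicConfiguration 3,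
        P.energyPerParticle lennardJones ≤ Q.energyPerParticle lennardJones) ↔ KeplerBound :=
  -- adapted from Cruxes/ExactCertificate/Disproof.lean §2 (`keplerBound_iff_periodicMinimiser`)
  periodicMinimum_iff_exists_isLeast.trans keplerBound_iff_exists_isLeast.symm

/-- **(b) `stub_periodicMinimum ↔ HasPeriodicGroundStateEnergy lennardJones 3`** (conjunct (i)
of the sub-problem `Crystallization`, the energetic form of the crystallization conjecture for
Lennard-Jones in `ℝ³`): the thermodynamic limit `E(N)/N → e*` holds unconditionally
(`BlancLewin2015_8_holds` + trial states + periodisation), so conjunct (i) is exactly the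
attainment of `e*`; packaged in the landed `keplerBound_iff_hasPeriodicGroundStateEnergy`.
[folklore] -/
theorem stub_periodicMinimum_iff_hasPeriodicGroundStateEnergy :
    (∃ P : PeriodicConfiguration 3, ∀ Q : PeriodicConfiguration 3,
        P.energyPerParticle lennardJones ≤ Q.energyPerParticle lennardJones) ↔
      HasPeriodicGroundStateEnergy lennardJones 3 :=
  -- adapted from Cruxes/ExactCertificate/Disproof.lean §2 (`periodicMinimiser_iff_conjunct_i`)
  stub_periodicMinimum_iff_keplerBound.trans keplerBound_iff_hasPeriodicGroundStateEnergy

/-- **(c) `KeplerBound → stub_periodicMinimum`**: the open route item 11961 discharges the stub.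
[folklore] -/
theorem stub_periodicMinimum_of_keplerBound (h : KeplerBound) :
    ∃ P : PeriodicConfiguration 3, ∀ Q : PeriodicConfiguration 3,
      P.energyPerParticle lennardJones ≤ Q.energyPerParticle lennardJones :=
  stub_periodicMinimum_iff_keplerBound.2 h

/-- **Conversely the stub gives `KeplerBound`**: a periodic minimiser `P` has
`N · e_LJ(P) = N · e* ≤ E_LJ(x)` for every finite injective `x`. [folklore] -/
theorem keplerBound_of_periodicMinimum
    (h : ∃ P : PeriodicConfiguration 3, ∀ Q : PeriodicConfiguration 3,
      P.energyPerParticle lennardJones ≤ Q.energyPerParticle lennardJones) : KeplerBound :=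
  stub_periodicMinimum_iff_keplerBound.1 h

/-- **And conjunct (i) discharges the stub** (its `IsLeast` clause alone suffices). [folklore] -/
theorem stub_periodicMinimum_of_hasPeriodicGroundStateEnergy
    (h : HasPeriodicGroundStateEnergy lennardJones 3) :
    ∃ P : PeriodicConfiguration 3, ∀ Q : PeriodicConfiguration 3,
      P.energyPerParticle lennardJones ≤ Q.energyPerParticle lennardJones :=
  stub_periodicMinimum_iff_hasPeriodicGroundStateEnergy.2 h

end Summit.AtomisticToContinuum.Crystallization.Theorems.ThreeConeCertificateExactCertificate

end
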